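import Mathlib.Topology.CWComplex.Classical.Finite
import Mathlib.Topology.Homotopy.Equiv
import Mathlib.Analysis.InnerProductSpace.PiL2
import Mathlib.Analysis.InnerProductSpace.Calculus
import Mathlib.Analysis.Calculus.ContDiff.Basic
import Mathlib.Analysis.Calculus.FDeriv.Symmetric
import Mathlib.LinearAlgebra.QuadraticForm.Signature
import HarnessLib

/-!
# Sha's theorem: a domain with `p`-convex boundary has the homotopy type of a `(p-1)`-complex
(topic `Literature/Geometry/Riemannian`; family SPC4, route `ConvexityLadder`)

**The printed results.**

* Sha, *`p`-convex Riemannian manifolds*, Invent. Math. 83 (1986), Thm. 1 (primary source;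
  paywalled, acquisition `acq-02458`; statement as restated by the two secondary sources below):
  a compact connected Riemannian manifold `M` with nonnegative sectional curvature and
  `p`-convex boundary — the sum of the `p` smallest principal curvatures of `∂M` with respect to
  the inner normal is positive — has the homotopy type of a CW complex of dimension `≤ p - 1`.
  Independently Wu, *Manifolds of partially positive curvature*, Indiana Univ. Math. J. 36
  (1987), Thm. 1.
* Xiong, *Homotopy type of manifolds with partially horoconvex boundary*, Int. J. Math. 29
  (2018), Thm. 4 (i) (held, `arXiv:1809.06982`, p. 3, with Definitions 1.1–1.2): "Let `M` be an
  `n`-dimensional compact Riemannian manifold with nonempty boundary `∂M` and let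
  `1 ≤ q ≤ n - 1` be an integer.  Suppose for some `κ > 0`, we have `K_q ≥ -qκ²` and
  `Λ_q ≥ qκ`" (`K_q` the minimal interior `q`-curvature, `Λ_q(x)` the minimum over
  `i₁ < ⋯ < i_q` of `λ_{i₁}(x) + ⋯ + λ_{i_q}(x)`, `λ₁ ≤ ⋯ ≤ λ_{n-1}` the eigenvalues of the
  Weingarten operator of `∂M`).  "Then (i) `M` has the homotopy type of a CW complex with a
  finite number of cells with dimension `≤ (q - 1)`."  Proof (p. 3 and §4): "The proofs … follow
  those in [Wu87, Sha86].  We first use the distance function from the boundary to construct a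
  suitable … `q`-convex function, then smooth it and apply the standard Morse theory"; the class
  `𝒞(q)` of `q`-convex functions is defined (Def. 2.1, after Wu) by
  `∑_{i=1}^q D²f(Xᵢ, Xᵢ) ≥ η > 0` for all orthonormal `{X₁, …, X_q}`.
* Harvey–Lawson, *`p`-convexity, `p`-plurisubharmonicity and the Levi problem*, Indiana Univ.
  Math. J. 62 (2013) (held, `arXiv:1111.3895`), §2, Remark after 2.4: "when `X` admits a
  strictly `p`-plurisubharmonic proper exhaustion function, standard Morse Theory implies that
  `X` has the homotopy-type of a complex of dimension `≤ p - 1` (cf. [S], [Wu])"; §5 (before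
  Thm. 5.9): "`∂Ω` is `p`-convex if `II_x` [the second fundamental form with respect to the
  interior normal] is `p`-positive at each point", `p`-positive meaning `tr(A|_W) ≥ 0` for all
  `p`-planes `W` (strictly: `> 0`).

**What is vendored (scope).**  Mathlib has neither sectional curvature nor the second
fundamental form of a hypersurface of a Riemannian manifold, so only the **flat case** is
stated — the case used by the route `Summits/SmoothPoincare4/…/Theses/ConvexityLadder` (items
`CvxThreeConvexBoundsTwoHandlebody`, `p = 3`, and `CvxTwoConvexStandard`, `p = 2`, in `ℝ⁵`), in
that route's currency: a compact regular sublevel domain `Ω = {F ≤ 0} ⊂ ℝⁿ⁺¹` of a smooth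
`F` (`DF ≠ 0` on `∂Ω = {F = 0}`), whose sectional curvature vanishes (`K_q = 0 ≥ -qκ²`), with
the `p`-convexity of `∂Ω` written on the defining function in Ky Fan's form

  `∑ᵢ D²F(x)(vᵢ, vᵢ) > 0` for every `x ∈ ∂Ω` and every orthonormal `p`-frame `(vᵢ)` in `ker DF(x) = T_x∂Ω`

(for `Ω = {F ≤ 0}` the inner normal is `ν = -∇F/|∇F|` and `II_ν(v, v) = D²F(v, v)/|∇F(x)|` on
`T_x∂Ω` — differentiate `F ∘ γ = 0` twice — so this is `tr(II|_W) > 0` for all tangent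
`p`-planes `W`, i.e. Sha's `λ₁ + ⋯ + λ_p > 0` by Ky Fan's minimum principle; on the compact `∂Ω`
it gives `Λ_p ≥ pκ` for some `κ > 0`).  Conclusion: `Ω`, with the subspace topology, is
homotopy equivalent (Mathlib `ContinuousMap.HomotopyEquiv`) to a finite CW complex (Mathlib
`Topology.CWComplex`, `Topology.RelCWComplex.Finite`) without cells of dimension `≥ p`.  This
is the named fact `Sha1986_homotopyEquiv_cwComplex_of_pConvex` (D-0014), for `1 ≤ p ≤ n` as printed
(Xiong: `1 ≤ q ≤ dim M - 1`).  Connectedness of `Ω` is not assumed (Xiong does not assume it;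
Sha's statement applies componentwise).

**Not vendored.**  (a) The general Riemannian statements (no substrate).  (b) The reading "for
domains in `ℝⁿ⁺¹`, a handle decomposition of `Ω` with handles of index `≤ p - 1`" asked for by
the work item: it is the *mechanism* of the printed proofs (a strictly `p`-convex Morse
function has index `≤ p - 1` at every critical point, and Morse theory attaches one handle per
critical point), but the sources read print the homotopy type only — Xiong, Remark 5,
explicitly contrasts Thm. 4 (i) for `q = 2` with Brendle–Huisken's theorem that such `M` "is
indeed diffeomorphic to a `1`-handlebody" — so no second named fact is minted (D-0026).  What is
**proved** here instead is the linear-algebraic core of that mechanism, in the forms the route's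
provers need: `sigNeg_lt_of_forall_orthonormal_sum_pos` (a quadratic form on a
finite-dimensional inner product space which has positive trace on every orthonormal `p`-frame
has negative index of inertia `< p`; Mathlib `sigNeg`, as used by the tree's
`Literature.Topology.FourManifolds.morseIndex`), its restriction to a subspace
`sigNeg_restrict_lt_of_forall_orthonormal_sum_pos`, and the definition-free
`not_exists_finrank_eq_neg_of_pConvex` for the route's literal clause (no `p`-dimensional
subspace of `ker DF(x)` on which `u ↦ D²F(x)(u, u)` is negative).  Also **proved**, as a check of
the sign conventions: the closed unit ball `{‖x‖² - 1 ≤ 0}` satisfies every hypothesis of the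
fact for every `p ≥ 1` (`pConvex_hypotheses_unitBall`).

## Mathlib / tree search

Mathlib (this pin): `Topology.CWComplex`, `Topology.RelCWComplex.Finite`,
`Topology.RelCWComplex.cell` (`Topology/CWComplex/Classical`), `ContinuousMap.HomotopyEquiv`,
`sigPos`/`sigNeg` with `exists_finrank_eq_sigNeg_and_negDef` (`LinearAlgebra/QuadraticForm/
Signature.lean`), `stdOrthonormalBasis`, `Orthonormal.comp_linearIsometry`, `contDiff_norm_sq`,
`fderiv_norm_sq_apply`; no Riemannian curvature of submanifolds, no Morse theory.  Tree
(`lean search`): `Literature.Topology.FourManifolds.morseIndex` (= `sigNeg` of `mhessian`),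
`IsMorseAdapted`, the height-function dictionary `HeightDictionary.*`
(`Hess ⟪v, f ·⟫ = -c⁻¹ D²F(df ·, df ·)`), the route file `ConvexityLadder`; nothing on
`p`-convexity (`lean search 'onvex'` in `Literature/Geometry`: unrelated).  Nothing here
duplicates an existing declaration; exactly one new named fact is introduced.

## References

* J.-P. Sha, *`p`-convex Riemannian manifolds*, Invent. Math. 83 (1986), 437–447, Thm. 1.
  [Sha1986]
* H. Wu, *Manifolds of partially positive curvature*, Indiana Univ. Math. J. 36 (1987),
  525–548, Thm. 1. [Wu1987]
* C. Xiong, *Homotopy type of manifolds with partially horoconvex boundary*, Int. J. Math. 29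
  (2018), 1850074, Thm. 4 (i), Def. 1.1–1.2, Def. 2.1, §4. [Xiong2018]
* F. R. Harvey, H. B. Lawson, *`p`-convexity, `p`-plurisubharmonicity and the Levi problem*,
  Indiana Univ. Math. J. 62 (2013), 149–169, §2 Remark after 2.4, §5. [HarveyLawson2013pConvexity]
* J.-P. Sha, *Handlebodies and `p`-convexity*, J. Differential Geom. 25 (1987) (the converse).
  [Sha1987]
-/

noncomputable section

open scoped ContDiff InnerProductSpace
open Module Topology

namespace Literature.Geometry.Riemannian

/-! ### The Ky Fan index lemma (proved) -/

section KyFan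

variable {V : Type*} [NormedAddCommGroup V] [InnerProductSpace ℝ V] [FiniteDimensional ℝ V]

/-- **A `p`-positive quadratic form has negative index of inertia `< p`** (the linear algebra
behind "a strictly `p`-convex Morse function has only critical points of index `≤ p - 1`",
the Morse-theoretic step of Sha 1986 / Wu 1987; Xiong 2018, Def. 2.1 and §4).  If a quadratic
form `Q` on a finite-dimensional real inner product space satisfies `∑ᵢ Q(vᵢ) > 0` for every
orthonormal `p`-frame `(v₁, …, v_p)`, then every subspace on which `Q` is negative definite
has dimension `< p`, i.e. `sigNeg Q < p`: a negative definite subspace of dimension `≥ p`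
contains an orthonormal `p`-frame (Gram–Schmidt, Mathlib `stdOrthonormalBasis`), on which the
sum is negative. [cite: Xiong2018, Def. 2.1 and §4] -/
theorem sigNeg_lt_of_forall_orthonormal_sum_pos (Q : QuadraticForm ℝ V) {p : ℕ}
    (h : ∀ v : Fin p → V, Orthonormal ℝ v → 0 < ∑ i, Q (v i)) : sigNeg Q < p := by
  by_contra hle
  have hle : p ≤ sigNeg Q := not_lt.mp hle
  obtain ⟨W, hW, hneg⟩ := exists_finrank_eq_sigNeg_and_negDef Q
  -- an orthonormal `p`-frame inside `W`
  have hp : p ≤ finrank ℝ W := hW ▸ hle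
  let b := stdOrthonormalBasis ℝ W
  let v : Fin p → V := fun i => (b (Fin.castLE hp i) : V)
  have hv : Orthonormal ℝ v :=
    ((b.orthonormal.comp _ (Fin.castLE_injective hp)).comp_linearIsometry W.subtypeₗᵢ)
  have hsum := h v hv
  -- but every term is negative
  have hlt : ∀ i, Q (v i) < 0 := fun i => by
    have hne : b (Fin.castLE hp i) ≠ 0 := b.orthonormal.ne_zero _
    have := hneg (b (Fin.castLE hp i)) hne
    simpa only [QuadraticMap.restrict_apply, QuadraticMap.neg_apply, neg_pos] using this
  rcases Nat.eq_zero_or_pos p with rfl | hp0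
  · simp at hsum
  · haveI : Nonempty (Fin p) := ⟨⟨0, hp0⟩⟩
    have : ∑ i, Q (v i) < 0 := Finset.sum_neg (fun i _ => hlt i) Finset.univ_nonempty
    exact absurd hsum (not_lt.mpr this.le)

/-- **The Ky Fan index lemma on a subspace** (the form in which it enters the height-function
argument: `Q` the Hessian of a defining function, `T` the tangent hyperplane).  If
`∑ᵢ Q(vᵢ) > 0` for every orthonormal `p`-frame `(vᵢ)` *contained in the subspace `T`*, then
the restriction `Q|_T` has negative index of inertia `< p`.
[cite: Xiong2018, Def. 2.1 and §4] -/
theorem sigNeg_restrict_lt_of_forall_orthonormal_sum_pos (Q : QuadraticForm ℝ V)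
    (T : Submodule ℝ V) {p : ℕ}
    (h : ∀ v : Fin p → V, Orthonormal ℝ v → (∀ i, v i ∈ T) → 0 < ∑ i, Q (v i)) :
    sigNeg (Q.restrict T) < p := by
  refine sigNeg_lt_of_forall_orthonormal_sum_pos (Q.restrict T) fun w hw => ?_
  have := h (fun i => (w i : V)) (hw.comp_linearIsometry T.subtypeₗᵢ) fun i => (w i).2
  simpa only [QuadraticMap.restrict_apply] using this

variable {E : Type*} [NormedAddCommGroup E] [InnerProductSpace ℝ E] [FiniteDimensional ℝ E]

/-- **No `p`-dimensional negative subspace** (definition-free form of the index bound, on the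
literal `p`-convexity clause of the route `ConvexityLadder`): if `F : E → ℝ` satisfies
`∑ᵢ D²F(x)(vᵢ, vᵢ) > 0` for every orthonormal `p`-frame `(vᵢ)` in `ker DF(x)`
(`iteratedFDeriv ℝ 2 F x ![vᵢ, vᵢ]`), then there is no `p`-dimensional subspace `W` of
`ker DF(x)` on which `u ↦ D²F(x)(u, u)` is negative away from `0` — so a height function of
`∂{F ≤ 0}` has Morse index `≤ p - 1` at every inward horizontal point (the handle-attaching
ones), the mechanism of the printed proofs (Sha 1986; Wu 1987; Xiong 2018, §4: "apply the
standard Morse theory"). [cite: Xiong2018, §4] -/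
theorem not_exists_finrank_eq_neg_of_pConvex (F : E → ℝ) (x : E) {p : ℕ}
    (h : ∀ v : Fin p → E, Orthonormal ℝ v → (∀ i, fderiv ℝ F x (v i) = 0) →
      0 < ∑ i, iteratedFDeriv ℝ 2 F x ![v i, v i]) :
    ¬ ∃ W : Submodule ℝ E, W ≤ LinearMap.ker (fderiv ℝ F x : E →ₗ[ℝ] ℝ) ∧
      finrank ℝ W = p ∧ ∀ u ∈ W, u ≠ 0 → iteratedFDeriv ℝ 2 F x ![u, u] < 0 := by
  rintro ⟨W, hWT, hW, hneg⟩
  let b := (stdOrthonormalBasis ℝ W).reindex (finCongr hW)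
  let v : Fin p → E := fun i => (b i : E)
  have hv : Orthonormal ℝ v := b.orthonormal.comp_linearIsometry W.subtypeₗᵢ
  have htan : ∀ i, fderiv ℝ F x (v i) = 0 := fun i => by
    have := hWT (b i).2
    rwa [LinearMap.mem_ker] at this
  have hsum := h v hv htan
  have hlt : ∀ i, iteratedFDeriv ℝ 2 F x ![v i, v i] < 0 := fun i =>
    hneg _ (b i).2 (by
      have := b.orthonormal.ne_zero i
      exact fun h0 => this (Subtype.ext h0))
  rcases Nat.eq_zero_or_pos p with rfl | hp0
  · simp at hsum
  · haveI : Nonempty (Fin p) := ⟨⟨0, hp0⟩⟩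
    have : ∑ i, iteratedFDeriv ℝ 2 F x ![v i, v i] < 0 :=
      Finset.sum_neg (fun i _ => hlt i) Finset.univ_nonempty
    exact absurd hsum (not_lt.mpr this.le)

end KyFan

/-! ### The named fact (flat case of Sha's theorem) -/

section Sha

/-- **Sha's theorem, flat case: a compact domain in `ℝⁿ⁺¹` with `p`-convex boundary has the
homotopy type of a finite CW complex of dimension `≤ p - 1`** (Sha, Invent. Math. 83 (1986),
Thm. 1: compact connected Riemannian `M` with `K ≥ 0` and `p`-convex boundary — sum of the `p`
smallest principal curvatures of `∂M` for the inner normal positive — has the homotopy type of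
a CW complex of dimension `≤ p - 1`; Wu, Indiana Univ. Math. J. 36 (1987), Thm. 1; restated and
reproved by Xiong, Int. J. Math. 29 (2018), Thm. 4 (i): for `1 ≤ q ≤ dim M - 1`, `K_q ≥ -qκ²`
and `Λ_q ≥ qκ` for some `κ > 0` imply "`M` has the homotopy type of a CW complex with a finite
number of cells with dimension `≤ (q - 1)`"; Harvey–Lawson (2013), §2: "standard Morse Theory
implies that `X` has the homotopy-type of a complex of dimension `≤ p - 1` (cf. [S], [Wu])").
Vendored in the flat case and in the currency of the route `ConvexityLadder` (module docstring,
*scope*): for `1 ≤ p ≤ n`, a smooth `F : ℝⁿ⁺¹ → ℝ` with compact `Ω = {F ≤ 0}`, `DF ≠ 0` on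
`{F = 0}`, and `∑ᵢ D²F(x)(vᵢ, vᵢ) > 0` for every `x ∈ {F = 0}` and every orthonormal `p`-frame
`(vᵢ)` in `ker DF(x)` (= `p`-convexity of `∂Ω` for the inner normal `-∇F/|∇F|`, since
`II(v, v) = D²F(v, v)/|∇F|`; `K ≡ 0`), the space `Ω` (subspace topology) is homotopy equivalent
to a finite CW complex `C` in some Hausdorff space with no cells of dimension `≥ p`.
Named fact (D-0014): the printed proof is a `p`-convex exhaustion built from the distance to
the boundary, Greene–Wu smoothing, and Morse theory (index `≤ p - 1` at every critical point:
`sigNeg_lt_of_forall_orthonormal_sum_pos`), none of which beyond the index bound is available.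
[cite: Sha1986, Thm. 1] [cite: Xiong2018, Thm. 4 (i)] [cite: Wu1987, Thm. 1]
[cite: HarveyLawson2013pConvexity, §2 Remark after 2.4] -/
def Sha1986_homotopyEquiv_cwComplex_of_pConvex : Prop :=
  ∀ (n p : ℕ) (F : EuclideanSpace ℝ (Fin (n + 1)) → ℝ), 1 ≤ p → p ≤ n →
    ContDiff ℝ ∞ F → IsCompact {x | F x ≤ 0} → (∀ x, F x = 0 → fderiv ℝ F x ≠ 0) →
    (∀ x, F x = 0 → ∀ v : Fin p → EuclideanSpace ℝ (Fin (n + 1)), Orthonormal ℝ v →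
      (∀ i, fderiv ℝ F x (v i) = 0) → 0 < ∑ i, iteratedFDeriv ℝ 2 F x ![v i, v i]) →
    ∃ (X : Type) (_ : TopologicalSpace X) (_ : T2Space X) (C : Set X) (_ : CWComplex C),
      RelCWComplex.Finite C ∧ (∀ m, p ≤ m → IsEmpty (RelCWComplex.cell C m)) ∧
        Nonempty (ContinuousMap.HomotopyEquiv {x // F x ≤ 0} C)

end Sha

/-! ### Sign check: the round ball -/

section Ball

variable {E : Type*} [NormedAddCommGroup E] [InnerProductSpace ℝ E]

/-- The second derivative of `x ↦ ‖x‖² - 1` is `2⟪u, w⟫`. [folklore] -/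
theorem iteratedFDeriv_two_norm_sq_sub_one (x u w : E) :
    iteratedFDeriv ℝ 2 (fun y : E => ‖y‖ ^ 2 - 1) x ![u, w] = 2 * ⟪u, w⟫_ℝ := by
  rw [iteratedFDeriv_two_apply]
  have h1 : fderiv ℝ (fun y : E => ‖y‖ ^ 2 - 1) = ⇑(2 • innerSL ℝ (E := E)) := by
    funext y
    rw [fderiv_sub_const, fderiv_norm_sq_apply]
    rfl
  rw [h1, ContinuousLinearMap.fderiv, two_mul]
  simp only [Matrix.cons_val_zero, Matrix.cons_val_one, two_smul]
  rfl

variable [FiniteDimensional ℝ E]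

/-- **The closed unit ball satisfies the hypotheses of `Sha1986_homotopyEquiv_cwComplex_of_pConvex`
for every `p ≥ 1`** (sign check of the convention `Ω = {F ≤ 0}`, inner normal `-∇F/|∇F|`:
with `F = ‖x‖² - 1`, `Ω` is the closed unit ball — convex, hence `p`-convex for all `p`, and
indeed of the homotopy type of a point, a `0`-complex): `F` is smooth, `{F ≤ 0}` is compact,
`DF(x) = 2⟪x, ·⟫ ≠ 0` on the unit sphere, and `∑ᵢ D²F(x)(vᵢ, vᵢ) = 2p > 0` on orthonormal
`p`-frames. [folklore] -/
theorem pConvex_hypotheses_unitBall {p : ℕ} (hp : 1 ≤ p) :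
    ContDiff ℝ ∞ (fun x : E => ‖x‖ ^ 2 - 1) ∧ IsCompact {x : E | ‖x‖ ^ 2 - 1 ≤ 0} ∧
      (∀ x : E, ‖x‖ ^ 2 - 1 = 0 → fderiv ℝ (fun y : E => ‖y‖ ^ 2 - 1) x ≠ 0) ∧
      ∀ x : E, ‖x‖ ^ 2 - 1 = 0 → ∀ v : Fin p → E, Orthonormal ℝ v →
        (∀ i, fderiv ℝ (fun y : E => ‖y‖ ^ 2 - 1) x (v i) = 0) →
          0 < ∑ i, iteratedFDeriv ℝ 2 (fun y : E => ‖y‖ ^ 2 - 1) x ![v i, v i] := by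
  refine ⟨(contDiff_norm_sq ℝ).sub contDiff_const, ?_, ?_, ?_⟩
  · have : {x : E | ‖x‖ ^ 2 - 1 ≤ 0} = Metric.closedBall (0 : E) 1 := by
      ext x
      simp only [Set.mem_setOf_eq, Metric.mem_closedBall, dist_zero_right, sub_nonpos]
      constructor
      · intro h
        nlinarith [norm_nonneg x]
      · intro h
        nlinarith [norm_nonneg x]
    rw [this]
    exact isCompact_closedBall _ _
  · intro x hx h0
    have hx1 : ‖x‖ ^ 2 = 1 := by linarith
    have : fderiv ℝ (fun y : E => ‖y‖ ^ 2 - 1) x x = 0 := by rw [h0]; rfl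
    rw [fderiv_sub_const, fderiv_norm_sq_apply] at this
    norm_num [innerSL_apply_apply, real_inner_self_eq_norm_sq, hx1] at this
  · intro x _ v hv _
    simp only [iteratedFDeriv_two_norm_sq_sub_one, real_inner_self_eq_norm_sq, hv.1, one_pow,
      mul_one, Finset.sum_const, Finset.card_univ, Fintype.card_fin, nsmul_eq_mul]
    have : (0 : ℝ) < p := by exact_mod_cast hp
    linarith

end Ball

end Literature.Geometry.Riemannian
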